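/-
Copyright (c) 2026 the pub-hodgecm-mathlib formalisation cell (harness21).  Prover seat hodgecm-mathlib-LH5-p02 (g2): line LH4 (Shalika pay-down), organ ‹RAO›, RAO-REG (II)
sub-brick «(A2) a-RADIUS CENTRALISER BALLS WITH SCALARS» (LH4-plan (g2) WORDS #31∕#36); 2026-09-02.
-/
import Literature.NumberTheory.Automorphic.UnitaryThreeRegularUnipotentOrbitFrame     -- ★ p849269∕p849290 (LH4-p02 (g2)): `n(a,s)`, `m_κ`, `d(z)`, `coe_regCentElt_mul`, `coe_transversal_conj_regCentElt`, `coe_torusElt_zpow_conj_upperTriangularUnipotent`, `isIntMatrix_upperTriangularUnipotent_iff`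
import HarnessLib

/-!
# The ball subgroups `Z(U)·B_{rₐ,r}` of the centraliser of a REGULAR unipotent of `U(3)`: subgroup, index = ball index on the skew line, absorption under `d^j·m_κ`
(Rogawski 1990 §3.9, §8.1; Ranga Rao 1972 — the centraliser side of the shell decomposition of a regular unipotent orbit)

Topic `NumberTheory/Automorphic`; namespace `Literature.NumberTheory.Automorphic.UnitaryGroup`.  THEOREMS ONLY (no definition, no instance, no notation, no named fact,
no `sorry`); kernel lane `--supports stmt-HodgeConjecture-24833`.  Cell `pub/hodgecm-mathlib` (D-0151), crux H413 = `stmt-HodgeConjecture-24833`; half A line LH4 (Shalika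
pay-down), organ ‹RAO›, REGULAR team: (I) covering F0P3a-p09 (g4), (II) shells LH5-p02 (g2) — THIS brick —, (B) shell sum ★ p849341 LH4-p03 (g3), (C) LH7-p01 (g2).
Sequel of ★ `UnitaryThreeRegularUnipotentOrbitFrame` §5 (`exists_subgroup_regCentBall`, `relIndex_regCentBall_eq`, `isIntMatrix_torusZpow_conj_transversal_conj_regCent`),
generalised in the two ways the shell data of the REGULAR orbit need: a UNITARY SCALAR factor `ζ` (`σζ·ζ = 1`: the centre `Z(U)`, which must sit inside the level-`j`
centraliser subgroups `S_j` for them to be OPEN in `C_U(u₀) = Z(U)·C_{U∩N}(u₀)`), and a second RADIUS `rₐ` on the `a`-coordinate (needed at the finitely many levels `j < 0`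
and to absorb the constant of the covering).  HONEST LABEL: HC_CM is proved only modulo the 7 printed citations (2 remaining named inputs: hLiu418 = stmt-HodgeConjecture-24832,
h413 = stmt-HodgeConjecture-24833) until rung 0 closes; count-neutral brick (matrix ∕ valuation algebra only).

* §1 `regCentMatrix_mul` — `n(a,s)·n(a′,s′) = n(a+a′, s+s′)` as a MATRIX identity (★ `coe_regCentElt_mul` read off units).
* §2 **`exists_subgroup_scalarRegCentBall (hσ) (h2) (rₐ r)`** — `{ζ • n(a,s) : σζ·ζ = 1, σa = a, σs = −s, v a ≤ rₐ, v s ≤ r}` is a subgroup of `GL₃(K)` (existential, no `def`);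
  **`relIndex_scalarRegCentBall_eq (h2) (hS) (hS′)`** — for two such subgroups with the same `rₐ` and radii `r, r′`: `[S_{r′} : S_r] = [{σs = −s, v s ≤ r′} : {σs = −s, v s ≤ r}]`
  (the coordinate `s = g₀₂∕g₀₀ + (g₀₁∕g₀₀)²∕2` is a homomorphism onto the skew line; same proof shape as ★ `relIndex_regCentBall_eq`).
* §3 **`isIntMatrix_torusZpow_conj_transversal_conj_scalarRegCent`** — ABSORPTION with general radii: `v a ≤ exp(−nₐ)`, `v s ≤ exp(2j)`, `v(κξ) ≤ exp(r′+2j)`, `r′ ≤ nₐ`, `−j ≤ nₐ`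
  ⇒ `d^j·(m_κ·(ζ • n(a,s))·m_κ⁻¹)·d^{−j}` is integral with integral inverse (`= diag(ζ)·` the unitriangular matrix of ★ §5, `v ζ = 1`).

## References
* [Rogawski1990] J. D. Rogawski, *Automorphic Representations of Unitary Groups in Three Variables*, Ann. of Math. Stud. 123 (1990), §1.10 p. 9; §3.9 p. 32; §8.1 p. 112.
* [Rao1972] R. Ranga Rao, *Orbital integrals in reductive groups*, Ann. of Math. (2) 96 (1972) 505–510, Theorem (p. 505).
-/

set_option autoImplicit false

open Matrix
open scoped Valued WithZero

namespace Literature.NumberTheory.Automorphic.UnitaryGroup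

open Literature.NumberTheory.Automorphic.HermitianLattice Literature.NumberTheory.Automorphic.UnitaryLatticeTree

variable {K : Type*} [Field K] (σ : K →+* K)

/-! ## §1 The additive law as a matrix identity -/

/-- Matrix product of the additive coordinates: `n(a,s)·n(a′,s′) = n(a+a′, s+s′)` on the nose (★ `coe_regCentElt_mul` read on matrices).
[cite: Rogawski1990, §1.10 p. 9] -/
theorem regCentMatrix_mul (h2 : (2 : K) ≠ 0) (a s a' s' : K) :
    (!![1, a, s - a ^ 2 / 2; 0, 1, -a; 0, 0, 1] : Matrix (Fin 3) (Fin 3) K) * !![1, a', s' - a' ^ 2 / 2; 0, 1, -a'; 0, 0, 1] =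
      !![1, a + a', (s + s') - (a + a') ^ 2 / 2; 0, 1, -(a + a'); 0, 0, 1] := by
  obtain ⟨n, hn, -⟩ := exists_units_coe_eq_upperTriangularUnipotent a (s - a ^ 2 / 2) (-a)
  obtain ⟨n', hn', -⟩ := exists_units_coe_eq_upperTriangularUnipotent a' (s' - a' ^ 2 / 2) (-a')
  rw [← hn, ← hn', ← Units.val_mul, coe_regCentElt_mul h2 hn hn']

/-! ## §2 The ball subgroups with scalars and two radii; §3 absorption -/

section Valued

variable [Valued K ℤᵐ⁰]

/-- **THE BALL SUBGROUPS `Z·B_{rₐ,r}` OF THE REGULAR CENTRALISER**: for radii `rₐ, r` the elements `ζ • n(a, s)` with `σζ·ζ = 1`, `σa = a`, `σs = −s`, `v a ≤ rₐ`, `v s ≤ r` form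
a SUBGROUP of `GL₃(K)` (the unitary scalars times the additive ball of the centraliser coordinates; `2 ∈ K^×`); stated existentially.  Generalises ★
`exists_subgroup_regCentBall` (`rₐ = 1`, no scalar). [cite: Rogawski1990, §3.9 p. 32; §8.1 p. 112] [cite: Rao1972, Theorem] -/
theorem exists_subgroup_scalarRegCentBall (hσ : ∀ z : K, σ (σ z) = z) (h2 : (2 : K) ≠ 0) (ra r : ℤᵐ⁰) :
    ∃ S : Subgroup (GL (Fin 3) K), ∀ g : GL (Fin 3) K, g ∈ S ↔
      ∃ ζ a s : K, σ ζ * ζ = 1 ∧ σ a = a ∧ σ s = -s ∧ Valued.v a ≤ ra ∧ Valued.v s ≤ r ∧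
        (g : Matrix (Fin 3) (Fin 3) K) = ζ • !![1, a, s - a ^ 2 / 2; 0, 1, -a; 0, 0, 1] := by
  refine ⟨{ carrier := {g | ∃ ζ a s : K, σ ζ * ζ = 1 ∧ σ a = a ∧ σ s = -s ∧ Valued.v a ≤ ra ∧ Valued.v s ≤ r ∧
      (g : Matrix (Fin 3) (Fin 3) K) = ζ • !![1, a, s - a ^ 2 / 2; 0, 1, -a; 0, 0, 1]}, mul_mem' := ?_, one_mem' := ?_, inv_mem' := ?_ },
    fun g => Iff.rfl⟩
  · rintro g g' ⟨ζ, a, s, hζ, ha, hs, hva, hvs, hg⟩ ⟨ζ', a', s', hζ', ha', hs', hva', hvs', hg'⟩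
    refine ⟨ζ * ζ', a + a', s + s', by rw [map_mul]; linear_combination ζ' * σ ζ' * hζ + hζ', by rw [map_add, ha, ha'],
      by rw [map_add, hs, hs', neg_add], (Valuation.map_add _ _ _).trans (max_le hva hva'), (Valuation.map_add _ _ _).trans (max_le hvs hvs'), ?_⟩
    rw [Units.val_mul, hg, hg', Matrix.smul_mul, Matrix.mul_smul, smul_smul, regCentMatrix_mul h2]
  · refine ⟨1, 0, 0, by rw [map_one, one_mul], map_zero σ, by rw [map_zero, neg_zero], by rw [map_zero]; exact zero_le, by rw [map_zero]; exact zero_le, ?_⟩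
    rw [Units.val_one, one_smul]
    ext i j; fin_cases i <;> fin_cases j <;> simp
  · rintro g ⟨ζ, a, s, hζ, ha, hs, hva, hvs, hg⟩
    have hζ0 : ζ ≠ 0 := right_ne_zero_of_mul_eq_one hζ
    refine ⟨σ ζ, -a, -s, by rw [hσ, mul_comm]; exact hζ, by rw [map_neg, ha], by rw [map_neg, hs, neg_neg], by rwa [Valuation.map_neg], by rwa [Valuation.map_neg], ?_⟩
    have hN : (!![1, a + -a, (s + -s) - (a + -a) ^ 2 / 2; 0, 1, -(a + -a); 0, 0, 1] : Matrix (Fin 3) (Fin 3) K) = 1 := by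
      ext i j; fin_cases i <;> fin_cases j <;> simp
    have hinv : (g : Matrix (Fin 3) (Fin 3) K) * (σ ζ • !![1, -a, -s - (-a) ^ 2 / 2; 0, 1, -(-a); 0, 0, 1]) = 1 := by
      rw [hg, Matrix.smul_mul, Matrix.mul_smul, smul_smul, regCentMatrix_mul h2, mul_comm ζ, hζ, one_smul, hN]
    rw [Matrix.coe_units_inv]
    exact Matrix.inv_eq_right_inv hinv

/-- **THE INDEX OF THE BALL SUBGROUPS IS THE BALL INDEX ON THE `s`-LINE** (scalar and `a`-radius carried along; generalises ★ `relIndex_regCentBall_eq`): for subgroups given by the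
predicates of `exists_subgroup_scalarRegCentBall` with the same `rₐ` and radii `r, r′`, `[S_{r′} : S_r] = [{σs = −s, v s ≤ r′} : {σs = −s, v s ≤ r}]` — the coordinate
`s = g₀₂∕g₀₀ + (g₀₁∕g₀₀)²∕2` is a homomorphism onto the anti-invariant line. [cite: Rogawski1990, §8.1 p. 112] [cite: Rao1972, Theorem] -/
theorem relIndex_scalarRegCentBall_eq (h2 : (2 : K) ≠ 0) {ra r r' : ℤᵐ⁰} {S S' : Subgroup (GL (Fin 3) K)}
    (hS : ∀ g : GL (Fin 3) K, g ∈ S ↔ ∃ ζ a s : K, σ ζ * ζ = 1 ∧ σ a = a ∧ σ s = -s ∧ Valued.v a ≤ ra ∧ Valued.v s ≤ r ∧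
      (g : Matrix (Fin 3) (Fin 3) K) = ζ • !![1, a, s - a ^ 2 / 2; 0, 1, -a; 0, 0, 1])
    (hS' : ∀ g : GL (Fin 3) K, g ∈ S' ↔ ∃ ζ a s : K, σ ζ * ζ = 1 ∧ σ a = a ∧ σ s = -s ∧ Valued.v a ≤ ra ∧ Valued.v s ≤ r' ∧
      (g : Matrix (Fin 3) (Fin 3) K) = ζ • !![1, a, s - a ^ 2 / 2; 0, 1, -a; 0, 0, 1]) :
    S.relIndex S' =
      ((Valued.v : Valuation K ℤᵐ⁰).leAddSubgroup r ⊓ (AddMonoidHom.id K + (σ : K →+* K).toAddMonoidHom).ker).relIndex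
        ((Valued.v : Valuation K ℤᵐ⁰).leAddSubgroup r' ⊓ (AddMonoidHom.id K + (σ : K →+* K).toAddMonoidHom).ker) := by
  classical
  -- the `s`-coordinate `g₀₂∕g₀₀ + (g₀₁∕g₀₀)² ∕ 2` and how it reads on `ζ • n(a, s)`
  have hcoord : ∀ {g : GL (Fin 3) K} {ζ a s : K}, σ ζ * ζ = 1 → (g : Matrix (Fin 3) (Fin 3) K) = ζ • !![1, a, s - a ^ 2 / 2; 0, 1, -a; 0, 0, 1] →
      (g : Matrix (Fin 3) (Fin 3) K) 0 2 / (g : Matrix (Fin 3) (Fin 3) K) 0 0 + ((g : Matrix (Fin 3) (Fin 3) K) 0 1 / (g : Matrix (Fin 3) (Fin 3) K) 0 0) ^ 2 / 2 = s := by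
    intro g ζ a s hζ hg
    have hζ0 : ζ ≠ 0 := right_ne_zero_of_mul_eq_one hζ
    rw [hg]; simp [hζ0]
  let φ : ↥S' →* Multiplicative K :=
    { toFun := fun g => Multiplicative.ofAdd (((g : GL (Fin 3) K) : Matrix (Fin 3) (Fin 3) K) 0 2 / ((g : GL (Fin 3) K) : Matrix (Fin 3) (Fin 3) K) 0 0 +
        (((g : GL (Fin 3) K) : Matrix (Fin 3) (Fin 3) K) 0 1 / ((g : GL (Fin 3) K) : Matrix (Fin 3) (Fin 3) K) 0 0) ^ 2 / 2)
      map_one' := by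
        rw [OneMemClass.coe_one, Units.val_one]
        simp
      map_mul' := by
        intro g g'
        obtain ⟨ζ, a, s, hζ, -, -, -, -, hg⟩ := (hS' g).1 g.2
        obtain ⟨ζ', a', s', hζ', -, -, -, -, hg'⟩ := (hS' g').1 g'.2
        have hζζ' : σ (ζ * ζ') * (ζ * ζ') = 1 := by rw [map_mul]; linear_combination ζ' * σ ζ' * hζ + hζ'
        have hgg' : (((g * g' : ↥S') : GL (Fin 3) K) : Matrix (Fin 3) (Fin 3) K) = (ζ * ζ') • !![1, a + a', (s + s') - (a + a') ^ 2 / 2; 0, 1, -(a + a'); 0, 0, 1] := by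
          rw [Subgroup.coe_mul, Units.val_mul, hg, hg', Matrix.smul_mul, Matrix.mul_smul, smul_smul, regCentMatrix_mul h2]
        rw [← ofAdd_add, hcoord hζζ' hgg', hcoord hζ hg, hcoord hζ' hg'] }
  have hφ : ∀ (g : ↥S') {ζ a s : K}, σ ζ * ζ = 1 → ((g : GL (Fin 3) K) : Matrix (Fin 3) (Fin 3) K) = ζ • !![1, a, s - a ^ 2 / 2; 0, 1, -a; 0, 0, 1] →
      φ g = Multiplicative.ofAdd s := fun g ζ a s hζ hg => by
    show Multiplicative.ofAdd _ = _
    rw [hcoord hζ hg]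
  -- the range of `φ` is the ball `B_{r′}` of the anti-invariant line
  have hrange : φ.range = AddSubgroup.toSubgroup
      ((Valued.v : Valuation K ℤᵐ⁰).leAddSubgroup r' ⊓ (AddMonoidHom.id K + (σ : K →+* K).toAddMonoidHom).ker) := by
    ext y
    rw [MonoidHom.mem_range]
    change _ ↔ Multiplicative.toAdd y ∈ ((Valued.v : Valuation K ℤᵐ⁰).leAddSubgroup r' ⊓ (AddMonoidHom.id K + (σ : K →+* K).toAddMonoidHom).ker)
    rw [AddSubgroup.mem_inf, Valuation.mem_leAddSubgroup_iff, AddMonoidHom.mem_ker]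
    constructor
    · rintro ⟨g, rfl⟩
      obtain ⟨ζ, a, s, hζ, -, hs, -, hvs, hg⟩ := (hS' g).1 g.2
      rw [hφ g hζ hg, toAdd_ofAdd]
      exact ⟨hvs, by simp [hs]⟩
    · rintro ⟨hvy, hσy⟩
      have hσy' : σ (Multiplicative.toAdd y) = -Multiplicative.toAdd y := by
        have h : Multiplicative.toAdd y + σ (Multiplicative.toAdd y) = 0 := by simpa using hσy
        linear_combination h
      obtain ⟨n, hn, -⟩ := exists_units_coe_eq_upperTriangularUnipotent (0 : K) (Multiplicative.toAdd y - (0 : K) ^ 2 / 2) (-0)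
      have hn1 : (n : Matrix (Fin 3) (Fin 3) K) = (1 : K) • !![1, 0, Multiplicative.toAdd y - (0 : K) ^ 2 / 2; 0, 1, -0; 0, 0, 1] := by rw [one_smul, hn]
      have hnS' : n ∈ S' := (hS' n).2 ⟨1, 0, Multiplicative.toAdd y, by rw [map_one, one_mul], map_zero σ, hσy', by rw [map_zero]; exact zero_le, hvy, hn1⟩
      exact ⟨⟨n, hnS'⟩, by rw [hφ ⟨n, hnS'⟩ (by rw [map_one, one_mul]) hn1, ofAdd_toAdd]⟩
  -- `S` inside `S'` is the preimage of the ball `B_r`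
  have hcomap : S.subgroupOf S' = (AddSubgroup.toSubgroup ((Valued.v : Valuation K ℤᵐ⁰).leAddSubgroup r)).comap φ := by
    ext g
    rw [Subgroup.mem_subgroupOf, Subgroup.mem_comap]
    change _ ↔ Multiplicative.toAdd (φ g) ∈ (Valued.v : Valuation K ℤᵐ⁰).leAddSubgroup r
    rw [Valuation.mem_leAddSubgroup_iff]
    obtain ⟨ζ, a, s, hζ, ha, hs, hva, hvs, hg⟩ := (hS' g).1 g.2
    rw [hφ g hζ hg, toAdd_ofAdd]
    constructor
    · intro hgS
      obtain ⟨ζ₁, a₁, s₁, hζ₁, -, -, -, hvs₁, hg₁⟩ := (hS (g : GL (Fin 3) K)).1 hgS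
      have : s₁ = s := by rw [← hcoord hζ₁ hg₁, hcoord hζ hg]
      rwa [← this]
    · intro hvsr
      exact (hS (g : GL (Fin 3) K)).2 ⟨ζ, a, s, hζ, ha, hs, hva, hvsr, hg⟩
  rw [Subgroup.relIndex, hcomap, Subgroup.index_comap, hrange, AddSubgroup.relIndex_toSubgroup]
  rw [← AddSubgroup.inf_relIndex_right ((Valued.v : Valuation K ℤᵐ⁰).leAddSubgroup r),
    ← AddSubgroup.inf_relIndex_right ((Valued.v : Valuation K ℤᵐ⁰).leAddSubgroup r ⊓ (AddMonoidHom.id K + (σ : K →+* K).toAddMonoidHom).ker)]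
  congr 1
  ext y
  simp only [AddSubgroup.mem_inf]
  tauto

/-- **ABSORPTION WITH A SCALAR AND GENERAL RADII**: `σ` isometric, `v 2 = 1`, `v z = exp(−1)`; radii: `v a ≤ exp(−nₐ)`, `v s ≤ exp(2j)`, `v(κξ) ≤ exp(r′ + 2j)` with
`r′ ≤ nₐ` and `−j ≤ nₐ`; `σζ·ζ = 1`.  Then `d^j · (m_κ · (ζ • n(a,s)) · m_κ⁻¹) · d^{−j}` is INTEGRAL together with its inverse (its matrix is
`ζ • !![1, z^j a, (zσz)^j(s − 2κξa − a²∕2); 0, 1, −(σz)^j a; 0, 0, 1]`).  Generalises ★ `isIntMatrix_torusZpow_conj_transversal_conj_regCent` (`ζ = 1`, `nₐ = 0 = r′ ≤ j`).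
[cite: Rogawski1990, §8.1 p. 112] [cite: Rao1972, Theorem] -/
theorem isIntMatrix_torusZpow_conj_transversal_conj_scalarRegCent (hσv : ∀ x : K, Valued.v (σ x) = Valued.v x) (hv2 : Valued.v (2 : K) = 1)
    {z ξ κ ζ a s : K} (hz : Valued.v z = WithZero.exp (-1 : ℤ)) {j na r' : ℤ} (hrn : r' ≤ na) (hjn : -j ≤ na)
    (hζ : σ ζ * ζ = 1) (ha : Valued.v a ≤ WithZero.exp (-na)) (hs : Valued.v s ≤ WithZero.exp (2 * j)) (hκ : Valued.v (κ * ξ) ≤ WithZero.exp (r' + 2 * j))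
    {d m g : GL (Fin 3) K} (hd : (d : Matrix (Fin 3) (Fin 3) K) = Matrix.diagonal ![z, 1, (σ z)⁻¹])
    (hm : (m : Matrix (Fin 3) (Fin 3) K) = !![1, κ * ξ, κ ^ 2 * ξ ^ 2 / 2; 0, 1, κ * ξ; 0, 0, 1])
    (hg : (g : Matrix (Fin 3) (Fin 3) K) = ζ • !![1, a, s - a ^ 2 / 2; 0, 1, -a; 0, 0, 1]) :
    IsIntMatrix ((d ^ j * (m * g * m⁻¹) * (d ^ j)⁻¹ : GL (Fin 3) K) : Matrix (Fin 3) (Fin 3) K) ∧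
      IsIntMatrix ((((d ^ j * (m * g * m⁻¹) * (d ^ j)⁻¹)⁻¹ : GL (Fin 3) K)) : Matrix (Fin 3) (Fin 3) K) := by
  have hz0 : z ≠ 0 := (Valuation.ne_zero_iff _).1 (by rw [hz]; exact WithZero.coe_ne_zero)
  have hζ0 : ζ ≠ 0 := right_ne_zero_of_mul_eq_one hζ
  have hvζ : Valued.v ζ = 1 := by
    have h := congrArg Valued.v hζ
    rw [map_mul, hσv, map_one] at h
    rcases le_or_gt (Valued.v ζ) 1 with hle | hgt
    · rcases hle.eq_or_lt with heq | hlt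
      · exact heq
      · exfalso
        have : Valued.v ζ * Valued.v ζ < 1 := by
          calc Valued.v ζ * Valued.v ζ ≤ Valued.v ζ * 1 := mul_le_mul_right hle _
            _ = Valued.v ζ := mul_one _
            _ < 1 := hlt
        exact this.ne h
    · exfalso
      have : 1 < Valued.v ζ * Valued.v ζ := by
        calc (1 : ℤᵐ⁰) < Valued.v ζ := hgt
          _ = Valued.v ζ * 1 := (mul_one _).symm
          _ ≤ Valued.v ζ * Valued.v ζ := mul_le_mul_right hgt.le _
      exact this.ne' h
  -- the unipotent part as a unit `g₁`, `g = s_ζ · g₁` with `s_ζ = diag(ζ, ζ, ζ)`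
  obtain ⟨g₁, hg₁, -⟩ := exists_units_coe_eq_upperTriangularUnipotent a (s - a ^ 2 / 2) (-a)
  obtain ⟨sζ, hsζ, hsζ'⟩ := exists_units_coe_eq_torusS (K := K) hζ0 hζ0
  have hscal : ∀ M : Matrix (Fin 3) (Fin 3) K, Matrix.diagonal ![ζ, ζ, ζ] * M = ζ • M ∧ M * Matrix.diagonal ![ζ, ζ, ζ] = ζ • M := by
    intro M
    have e : Matrix.diagonal ![ζ, ζ, ζ] = ζ • (1 : Matrix (Fin 3) (Fin 3) K) := by
      ext i j; fin_cases i <;> fin_cases j <;> simp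
    rw [e, Matrix.smul_mul, Matrix.mul_smul, Matrix.one_mul, Matrix.mul_one]
    exact ⟨rfl, rfl⟩
  have hggs : g = sζ * g₁ := Units.ext (by rw [Units.val_mul, hsζ, (hscal _).1, hg₁, hg])
  -- `s_ζ` is central: the conjugate splits as `s_ζ · (d^j (m g₁ m⁻¹) d^{−j})`
  have hcomm : ∀ h : GL (Fin 3) K, h * sζ = sζ * h := fun h => Units.ext (by rw [Units.val_mul, Units.val_mul, hsζ, (hscal _).1, (hscal _).2])
  have hsplit : d ^ j * (m * g * m⁻¹) * (d ^ j)⁻¹ = sζ * (d ^ j * (m * g₁ * m⁻¹) * (d ^ j)⁻¹) := by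
    rw [hggs]
    calc d ^ j * (m * (sζ * g₁) * m⁻¹) * (d ^ j)⁻¹ = d ^ j * (sζ * (m * g₁ * m⁻¹)) * (d ^ j)⁻¹ := by
          rw [← mul_assoc m sζ g₁, hcomm m, mul_assoc sζ m g₁, mul_assoc sζ (m * g₁) m⁻¹]
      _ = sζ * (d ^ j * (m * g₁ * m⁻¹) * (d ^ j)⁻¹) := by
          rw [← mul_assoc (d ^ j) sζ, hcomm (d ^ j), mul_assoc sζ (d ^ j), mul_assoc sζ (d ^ j * (m * g₁ * m⁻¹))]
  -- the unipotent factor and its integrality (the computation of ★ `isIntMatrix_torusZpow_conj_transversal_conj_regCent` with general radii)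
  have hconj := coe_torusElt_zpow_conj_upperTriangularUnipotent σ hz0 hd (coe_transversal_conj_regCentElt hm hg₁) j
  have hvz : Valued.v (z ^ j) = WithZero.exp (-j) := by rw [map_zpow₀, hz, ← WithZero.exp_zsmul]; congr 1; ring
  have hvσz : Valued.v ((σ z) ^ j) = WithZero.exp (-j) := by rw [map_zpow₀, hσv, hz, ← WithZero.exp_zsmul]; congr 1; ring
  have hvN : Valued.v ((z * σ z) ^ j) = WithZero.exp (-(2 * j)) := by
    rw [map_zpow₀, Valuation.map_mul, hσv, hz, ← WithZero.exp_add, ← WithZero.exp_zsmul]; congr 1; ring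
  have h01 : Valued.v (z ^ j * a) ≤ 1 := by
    rw [Valuation.map_mul, hvz]
    calc WithZero.exp (-j) * Valued.v a ≤ WithZero.exp (-j) * WithZero.exp (-na) := mul_le_mul_right ha _
      _ ≤ 1 := by rw [← WithZero.exp_add, ← WithZero.exp_zero]; exact WithZero.exp_le_exp.2 (by omega)
  have h12 : Valued.v ((σ z) ^ j * -a) ≤ 1 := by
    rw [Valuation.map_mul, Valuation.map_neg, hvσz]
    calc WithZero.exp (-j) * Valued.v a ≤ WithZero.exp (-j) * WithZero.exp (-na) := mul_le_mul_right ha _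
      _ ≤ 1 := by rw [← WithZero.exp_add, ← WithZero.exp_zero]; exact WithZero.exp_le_exp.2 (by omega)
  have h02 : Valued.v ((z * σ z) ^ j * ((s - 2 * κ * ξ * a) - a ^ 2 / 2)) ≤ 1 := by
    have hinner : Valued.v ((s - 2 * κ * ξ * a) - a ^ 2 / 2) ≤ WithZero.exp (2 * j) := by
      refine (Valuation.map_sub _ _ _).trans (max_le ((Valuation.map_sub _ _ _).trans (max_le hs ?_)) ?_)
      · rw [show 2 * κ * ξ * a = 2 * (κ * ξ) * a by ring, Valuation.map_mul, Valuation.map_mul, hv2, one_mul]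
        calc Valued.v (κ * ξ) * Valued.v a ≤ WithZero.exp (r' + 2 * j) * WithZero.exp (-na) := mul_le_mul' hκ ha
          _ ≤ WithZero.exp (2 * j) := by rw [← WithZero.exp_add]; exact WithZero.exp_le_exp.2 (by omega)
      · rw [map_div₀, hv2, div_one, Valuation.map_pow]
        calc Valued.v a ^ 2 ≤ WithZero.exp (-na) ^ 2 := pow_le_pow_left₀ zero_le ha 2
          _ = WithZero.exp (-na + -na) := by rw [pow_two, WithZero.exp_add]
          _ ≤ WithZero.exp (2 * j) := WithZero.exp_le_exp.2 (by omega)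
    rw [Valuation.map_mul, hvN]
    calc WithZero.exp (-(2 * j)) * Valued.v ((s - 2 * κ * ξ * a) - a ^ 2 / 2)
        ≤ WithZero.exp (-(2 * j)) * WithZero.exp (2 * j) := mul_le_mul' le_rfl hinner
      _ = 1 := by rw [← WithZero.exp_add, neg_add_cancel, WithZero.exp_zero]
  have hX : IsIntMatrix ((d ^ j * (m * g₁ * m⁻¹) * (d ^ j)⁻¹ : GL (Fin 3) K) : Matrix (Fin 3) (Fin 3) K) :=
    (isIntMatrix_upperTriangularUnipotent_iff hconj).2 ⟨h01, h02, h12⟩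
  have hXi : IsIntMatrix ((((d ^ j * (m * g₁ * m⁻¹) * (d ^ j)⁻¹)⁻¹ : GL (Fin 3) K)) : Matrix (Fin 3) (Fin 3) K) :=
    isIntMatrix_inv_of_upperTriangularUnipotent hconj h01 h02 h12
  -- the scalar factor is integral with integral inverse
  have hsI : IsIntMatrix (sζ : Matrix (Fin 3) (Fin 3) K) := by
    rw [hsζ]; intro i k; fin_cases i <;> fin_cases k <;> simp [hvζ]
  have hsI' : IsIntMatrix ((sζ⁻¹ : GL (Fin 3) K) : Matrix (Fin 3) (Fin 3) K) := by
    rw [hsζ']; intro i k; fin_cases i <;> fin_cases k <;> simp [hvζ]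
  rw [hsplit, _root_.mul_inv_rev, Units.val_mul, Units.val_mul]
  exact ⟨isIntMatrix_mul hsI hX, isIntMatrix_mul hXi hsI'⟩

end Valued

end Literature.NumberTheory.Automorphic.UnitaryGroup
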